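import Literature.Analysis.Hypoelliptic.FieldLink
import Literature.Analysis.Distribution.Hypoelliptic
import Mathlib.MeasureTheory.Measure.Haar.Unique
import Mathlib.MeasureTheory.Measure.Haar.InnerProductSpace
import HarnessLib

/-!
# Transport between the `x`-space `E` and the Fourier model space `V`

Analysis/Hypoelliptic support file serving the discharge of
`Literature.Analysis.Distribution.Hormander1967_thm11`.

For a continuous linear equivalence `T : E ≃L[ℝ] V`:

* **change of variables for Haar measures** (`exists_integral_comp_eq`): `∫ g ∘ T dμ = c_T ∫ g`
  with `c_T ≠ 0`;
* **Schwartz avatars** of compactly supported smooth functions (`exists_avatar`,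
  `exists_avatarV`);
* pushforward of vector fields `push T X = T ∘ X ∘ T⁻¹`, its compatibility with Lie brackets,
  with Hörmander's first-order operators and with the formal transposes
  (`fieldTranspose_comp`, `hormanderTranspose_comp`);
* the flat operator of a real family is minus the formal transpose of its vector field
  (`flatC_ofReal`);
* locality of the formal transposes;
* iterated brackets as words (`IsIteratedLieBracket.exists_word`) and extraction of finitely many
  spanning brackets (`exists_spanning_words`).

## References

* L. Hörmander, Acta Math. 119 (1967), §1 (folklore bookkeeping).
-/

noncomputable section

open MeasureTheory Set Filter Function SchwartzMap VectorField TopologicalSpace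
open scoped Topology ComplexConjugate InnerProductSpace BigOperators ContDiff ENNReal NNReal

namespace Literature.Analysis.Hypoelliptic

open Literature.Analysis.Distribution

variable {E : Type*} [NormedAddCommGroup E] [NormedSpace ℝ E]
variable {V : Type*} [NormedAddCommGroup V] [InnerProductSpace ℝ V]

/-! ### Change of variables for Haar measures -/

/-- **`∫ g ∘ T dμ = c_T ∫ g` with `c_T ≠ 0`** for an additive Haar measure `μ` on `E` and the
volume of the finite-dimensional inner product space `V`. [folklore] -/
theorem exists_integral_comp_eq [FiniteDimensional ℝ E] [MeasurableSpace E] [BorelSpace E]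
    [FiniteDimensional ℝ V] [MeasurableSpace V] [BorelSpace V]
    (μ : Measure E) [μ.IsAddHaarMeasure] (T : E ≃L[ℝ] V) :
    ∃ cT : ℝ, cT ≠ 0 ∧ ∀ g : V → ℂ, ∫ x, g (T x) ∂μ = (cT : ℂ) * ∫ y, g y := by
  set ν : Measure V := μ.map T with hν
  haveI : ν.IsAddHaarMeasure := T.isAddHaarMeasure_map μ
  have hνeq : ν = Measure.addHaarScalarFactor ν volume • (volume : Measure V) :=
    Measure.isAddLeftInvariant_eq_smul ν volume
  have hpos : 0 < Measure.addHaarScalarFactor ν (volume : Measure V) :=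
    Measure.addHaarScalarFactor_pos_of_isAddHaarMeasure ν volume
  refine ⟨Measure.addHaarScalarFactor ν volume, (NNReal.coe_pos.2 hpos).ne', fun g => ?_⟩
  have h1 : ∫ x, g (T x) ∂μ = ∫ y, g y ∂ν := by
    rw [hν]
    have := integral_map_equiv (μ := μ) T.toHomeomorph.toMeasurableEquiv g
    rw [Homeomorph.toMeasurableEquiv_coe] at this
    exact this.symm
  rw [h1]
  conv_lhs => rw [hνeq]
  rw [integral_smul_nnreal_measure, NNReal.smul_def, Complex.real_smul]

/-! ### Schwartz avatars -/

/-- **Avatars on `V`**: a compactly supported smooth function on `V` is (the coercion of) a Schwartz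
function. [folklore] -/
theorem exists_avatarV {f : V → ℂ} (hf : ContDiff ℝ ∞ f) (hs : HasCompactSupport f) :
    ∃ q : 𝓢(V, ℂ), ∀ y, f y = q y :=
  ⟨hs.toSchwartzMap hf, fun _ => rfl⟩

/-- **Avatars through `T`**: `f = q ∘ T` for compactly supported smooth `f : E → ℂ`. [folklore] -/
theorem exists_avatar (T : E ≃L[ℝ] V) {f : E → ℂ} (hf : ContDiff ℝ ∞ f) (hs : HasCompactSupport f) :
    ∃ q : 𝓢(V, ℂ), ∀ x, f x = q (T x) := by
  have h1 : ContDiff ℝ ∞ (fun y => f (T.symm y)) := hf.comp T.symm.contDiff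
  have h2 : HasCompactSupport (fun y => f (T.symm y)) := hs.comp_homeomorph T.symm.toHomeomorph
  exact ⟨h2.toSchwartzMap h1, fun x => by show f x = f (T.symm (T x)); simp⟩

/-- Real avatars are conjugation invariant. [folklore] -/
theorem exists_avatar_real (T : E ≃L[ℝ] V) {f : E → ℝ} (hf : ContDiff ℝ ∞ f) (hs : HasCompactSupport f) :
    ∃ q : 𝓢(V, ℂ), (∀ x, (f x : ℂ) = q (T x)) ∧ ∀ y, conj (q y) = q y := by
  obtain ⟨q, hq⟩ := exists_avatar T (f := fun x => (f x : ℂ)) (Complex.ofRealCLM.contDiff.comp hf :)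
    (hs.comp_left Complex.ofReal_zero :)
  refine ⟨q, hq, fun y => ?_⟩
  have := hq (T.symm y)
  simp only [ContinuousLinearEquiv.apply_symm_apply] at this
  rw [← this, Complex.conj_ofReal]

/-- Real avatars on `V`. [folklore] -/
theorem exists_avatarV_real {f : V → ℝ} (hf : ContDiff ℝ ∞ f) (hs : HasCompactSupport f) :
    ∃ q : 𝓢(V, ℂ), (∀ y, (f y : ℂ) = q y) ∧ ∀ y, conj (q y) = q y := by
  obtain ⟨q, hq⟩ := exists_avatarV (f := fun y => (f y : ℂ)) (Complex.ofRealCLM.contDiff.comp hf :)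
    (hs.comp_left Complex.ofReal_zero :)
  exact ⟨q, hq, fun y => by rw [← hq y]; exact Complex.conj_ofReal _⟩

/-! ### Pushforward of vector fields -/

/-- The pushforward `T_* X = T ∘ X ∘ T⁻¹`. [folklore] -/
def push (T : E ≃L[ℝ] V) (X : E → E) : V → V := fun y => T (X (T.symm y))

/-- (structural lemma) [folklore] -/
theorem push_apply (T : E ≃L[ℝ] V) (X : E → E) (x : E) : push T X (T x) = T (X x) := by
  simp [push]

/-- Smoothness of the pushforward. [folklore] -/
theorem contDiff_push (T : E ≃L[ℝ] V) {X : E → E} (hX : ContDiff ℝ ∞ X) : ContDiff ℝ ∞ (push T X) :=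
  T.contDiff.comp (hX.comp T.symm.contDiff)

/-- The derivative of the pushforward. [folklore] -/
theorem fderiv_push (T : E ≃L[ℝ] V) {X : E → E} (hX : Differentiable ℝ X) (x : E) (w : V) :
    fderiv ℝ (push T X) (T x) w = T (fderiv ℝ X x (T.symm w)) := by
  have h1 : HasFDerivAt (fun y : V => X (T.symm y)) ((fderiv ℝ X (T.symm (T x))).comp (T.symm : V →L[ℝ] E)) (T x) :=
    (hX _).hasFDerivAt.comp (T x) T.symm.hasFDerivAt
  have h2 : HasFDerivAt (push T X)
      ((T : E →L[ℝ] V).comp ((fderiv ℝ X (T.symm (T x))).comp (T.symm : V →L[ℝ] E))) (T x) :=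
    (T : E →L[ℝ] V).hasFDerivAt.comp (T x) h1
  rw [h2.fderiv, T.symm_apply_apply]
  rfl

/-- **Pushforward commutes with Lie brackets.** [folklore] -/
theorem push_lieBracket (T : E ≃L[ℝ] V) {X Y : E → E} (hX : Differentiable ℝ X) (hY : Differentiable ℝ Y) :
    push T (lieBracket ℝ X Y) = lieBracket ℝ (push T X) (push T Y) := by
  ext y
  obtain ⟨x, rfl⟩ : ∃ x, y = T x := ⟨T.symm y, by simp⟩
  rw [push_apply, lieBracket, lieBracket, fderiv_push T hY, fderiv_push T hX, push_apply, push_apply]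
  simp

/-! ### Transport of Hörmander's first-order operators -/

/-- `X (F ∘ T) = ((T_*X) F) ∘ T`. [folklore] -/
theorem fieldDeriv_comp (T : E ≃L[ℝ] V) (X : E → E) {F : V → ℝ} (hF : Differentiable ℝ F) (x : E) :
    fieldDeriv X (fun x => F (T x)) x = fieldDeriv (push T X) F (T x) := by
  simp only [fieldDeriv_apply, push_apply]
  rw [show (fun x => F (T x)) = F ∘ (T : E → V) from rfl, fderiv_comp x (hF _) T.differentiableAt]
  simp [ContinuousLinearEquiv.fderiv]

/-- `div X = (div T_*X) ∘ T`. [folklore] -/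
theorem fieldDiv_comp (T : E ≃L[ℝ] V) {X : E → E} (hX : Differentiable ℝ X) (x : E) :
    fieldDiv X x = fieldDiv (push T X) (T x) := by
  unfold fieldDiv
  have h : (fderiv ℝ (push T X) (T x) : V →ₗ[ℝ] V) =
      (T.toLinearEquiv : E ≃ₗ[ℝ] V).conj (fderiv ℝ X x : E →ₗ[ℝ] E) := by
    ext w
    simp only [ContinuousLinearMap.coe_coe, LinearEquiv.conj_apply, LinearMap.coe_comp, LinearEquiv.coe_coe,
      Function.comp_apply]
    rw [fderiv_push T hX]
    rfl
  rw [h, LinearMap.trace_conj']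

/-- **`ᵗX (F ∘ T) = (ᵗ(T_*X) F) ∘ T`.** [folklore] -/
theorem fieldTranspose_comp (T : E ≃L[ℝ] V) {X : E → E} (hX : Differentiable ℝ X) {F : V → ℝ}
    (hF : Differentiable ℝ F) (x : E) :
    fieldTranspose X (fun x => F (T x)) x = fieldTranspose (push T X) F (T x) := by
  unfold fieldTranspose
  rw [fieldDeriv_comp T X hF, fieldDiv_comp T hX]

/-- **`ᵗP (F ∘ T) = (ᵗP^V F) ∘ T`** for the pushed-forward data. [folklore] -/
theorem hormanderTranspose_comp [FiniteDimensional ℝ E] [FiniteDimensional ℝ V] {ι : Type*} [Fintype ι]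
    (T : E ≃L[ℝ] V) {X₀ : E → E} {X : ι → E → E}
    (hX₀ : ContDiff ℝ ∞ X₀) (hX : ∀ j, ContDiff ℝ ∞ (X j)) (c : E → ℝ) {F : V → ℝ} (hF : ContDiff ℝ ∞ F) (x : E) :
    hormanderTranspose X₀ X c (fun x => F (T x)) x =
      hormanderTranspose (push T X₀) (fun j => push T (X j)) (fun y => c (T.symm y)) F (T x) := by
  unfold hormanderTranspose
  have hXd : ∀ j, Differentiable ℝ (X j) := fun j => (hX j).differentiable (by simp)
  have hFd : Differentiable ℝ F := hF.differentiable (by simp)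
  have h1 : ∀ j, fieldTranspose (X j) (fieldTranspose (X j) fun x => F (T x)) x =
      fieldTranspose (push T (X j)) (fieldTranspose (push T (X j)) F) (T x) := by
    intro j
    have e : fieldTranspose (X j) (fun x => F (T x)) = fun x => fieldTranspose (push T (X j)) F (T x) :=
      funext fun x => fieldTranspose_comp T (hXd j) hFd x
    rw [e, fieldTranspose_comp T (hXd j)]
    exact (contDiff_fieldTranspose (contDiff_push T (hX j)) hF).differentiable (by simp)
  simp only [h1, fieldTranspose_comp T (hX₀.differentiable (by simp)) hFd]
  simp

/-! ### The flat operator of a real family is minus the formal transpose -/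

section Flat

variable {n : ℕ} {e : Fin n → V} {a : Fin n → V → ℂ}

/-- The derivation of a real family on a real function. [folklore] -/
theorem XdC_ofReal (ha : RealFam a) {F : V → ℝ} (hF : Differentiable ℝ F) (y : V) :
    XdC e a (fun y => (F y : ℂ)) y = (fieldDeriv (vfR e a) F y : ℂ) := by
  simp only [XdC, fieldDeriv_apply, vfR, map_sum, map_smul, smul_eq_mul]
  push_cast
  refine Finset.sum_congr rfl fun l _ => ?_
  rw [ha.ofReal_re, pd_apply]
  congr 1
  have h := ((hF y).hasFDerivAt)
  have h2 : HasFDerivAt (fun y => (F y : ℂ)) (Complex.ofRealCLM.comp (fderiv ℝ F y)) y :=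
    Complex.ofRealCLM.hasFDerivAt.comp y h
  rw [h2.fderiv]
  simp

/-- The derivative of `vfR e a`. [folklore] -/
theorem hasFDerivAt_vfR (ha : SmoothFam a) (y : V) :
    HasFDerivAt (vfR e a) (∑ l, (Complex.reCLM.comp (fderiv ℝ (a l) y)).smulRight (e l)) y := by
  unfold vfR
  refine HasFDerivAt.fun_sum fun l _ => ?_
  have h1 : HasFDerivAt (fun y => (a l y).re) (Complex.reCLM.comp (fderiv ℝ (a l) y)) y :=
    Complex.reCLM.hasFDerivAt.comp y (((ha l).differentiable (by simp)) y).hasFDerivAt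
  exact h1.smul_const (e l)

/-- The divergence of the vector field of a real family. [folklore] -/
theorem divC_ofReal [FiniteDimensional ℝ V] (ha : RealFam a) (has : SmoothFam a) (y : V) :
    divC e a y = (fieldDiv (vfR e a) y : ℂ) := by
  unfold fieldDiv
  rw [(hasFDerivAt_vfR has y).fderiv, ContinuousLinearMap.toLinearMap_sum, map_sum]
  have htr : ∀ l, LinearMap.trace ℝ V
      (((Complex.reCLM.comp (fderiv ℝ (a l) y)).smulRight (e l) : V →L[ℝ] V) : V →ₗ[ℝ] V) =
        (fderiv ℝ (a l) y (e l)).re := fun l =>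
    LinearMap.trace_smulRight ((Complex.reCLM.comp (fderiv ℝ (a l) y) : V →L[ℝ] ℝ) : V →ₗ[ℝ] ℝ) (e l)
  simp only [htr]
  rw [divC]
  push_cast
  refine Finset.sum_congr rfl fun l _ => ?_
  rw [pd_apply]
  have hreal : conj (fderiv ℝ (a l) y (e l)) = fderiv ℝ (a l) y (e l) :=
    conj_fderiv_apply (ha l) ((has l).differentiable (by simp)) y (e l)
  apply Complex.ext <;> simp [Complex.conj_eq_iff_im.1 hreal]

/-- **`♭ F = -ᵗX F`** for the vector field `X = vfR e a` of a real smooth family and real `F`.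
[folklore] -/
theorem flatC_ofReal [FiniteDimensional ℝ V] (ha : RealFam a) (has : SmoothFam a) {F : V → ℝ}
    (hF : ContDiff ℝ ∞ F) (y : V) :
    flatC e a (fun y => (F y : ℂ)) y = -(fieldTranspose (vfR e a) F y : ℂ) := by
  rw [has.flatC_eq (h := fun y => (F y : ℂ)) (Complex.ofRealCLM.contDiff.comp hF),
    XdC_ofReal ha (hF.differentiable (by simp)),
    divC_ofReal ha has, fieldTranspose]
  push_cast
  ring

end Flat

/-! ### Locality of the formal transposes -/

section Locality

variable {W : Type*} [NormedAddCommGroup W] [NormedSpace ℝ W]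

/-- `ᵗX f y` depends only on the germs of `X` and `f` at `y`. [folklore] -/
theorem fieldTranspose_congr {X X' : W → W} {f f' : W → ℝ} {y : W} (hX : X =ᶠ[𝓝 y] X') (hf : f =ᶠ[𝓝 y] f') :
    fieldTranspose X f y = fieldTranspose X' f' y := by
  unfold fieldTranspose fieldDiv
  rw [fieldDeriv_apply, fieldDeriv_apply, hf.fderiv_eq, hX.fderiv_eq, hX.self_of_nhds, hf.self_of_nhds]

/-- Germ version. [folklore] -/
theorem fieldTranspose_eventuallyEq {X X' : W → W} {f f' : W → ℝ} {y : W} (hX : X =ᶠ[𝓝 y] X')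
    (hf : f =ᶠ[𝓝 y] f') : fieldTranspose X f =ᶠ[𝓝 y] fieldTranspose X' f' := by
  filter_upwards [hX.eventuallyEq_nhds, hf.eventuallyEq_nhds] with z hXz hfz
  exact fieldTranspose_congr hXz hfz

/-- `ᵗP f y` depends only on the germs of the data and of `f` at `y`. [folklore] -/
theorem hormanderTranspose_congr {ι : Type*} [Fintype ι] {X₀ X₀' : W → W} {X X' : ι → W → W}
    {c c' f f' : W → ℝ} {y : W} (hX₀ : X₀ =ᶠ[𝓝 y] X₀') (hX : ∀ j, X j =ᶠ[𝓝 y] X' j)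
    (hc : c =ᶠ[𝓝 y] c') (hf : f =ᶠ[𝓝 y] f') :
    hormanderTranspose X₀ X c f y = hormanderTranspose X₀' X' c' f' y := by
  unfold hormanderTranspose
  have h1 : ∀ j, fieldTranspose (X j) (fieldTranspose (X j) f) y =
      fieldTranspose (X' j) (fieldTranspose (X' j) f') y := fun j =>
    fieldTranspose_congr (hX j) (fieldTranspose_eventuallyEq (hX j) hf)
  simp only [h1, fieldTranspose_congr hX₀ hf, hc.self_of_nhds, hf.self_of_nhds]

/-- The formal transpose of a field vanishing near `y` vanishes at `y`. [folklore] -/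
theorem fieldTranspose_eq_zero_of_eventuallyEq {X : W → W} {y : W} (hX : X =ᶠ[𝓝 y] fun _ => 0) (f : W → ℝ) :
    fieldTranspose X f y = 0 := by
  rw [fieldTranspose_congr hX (Filter.EventuallyEq.refl _ f)]
  simp [fieldTranspose, fieldDiv]

end Locality

/-! ### Iterated brackets as words; finitely many spanning brackets -/

section WordsE

variable {ι : Type*} (X₀ : E → E) {J : ℕ} (XJ : Fin J → E → E)

/-- Iterated brackets of the `E`-side fields along a word. [folklore] -/
def ebr : BWord J → E → E
  | BWord.base j => XJ j
  | BWord.base0 => X₀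
  | BWord.consJ j w => lieBracket ℝ (XJ j) (ebr w)
  | BWord.cons0 w => lieBracket ℝ X₀ (ebr w)

/-- All field indices of a word satisfy `P`. [folklore] -/
def _root_.Literature.Analysis.Hypoelliptic.BWord.IdxIn (P : Fin J → Prop) : BWord J → Prop
  | BWord.base j => P j
  | BWord.base0 => True
  | BWord.consJ j w => P j ∧ BWord.IdxIn P w
  | BWord.cons0 w => BWord.IdxIn P w

/-- Monotonicity of `IdxIn`. [folklore] -/
theorem _root_.Literature.Analysis.Hypoelliptic.BWord.IdxIn.mono {P Q : Fin J → Prop} (h : ∀ j, P j → Q j) :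
    ∀ (w : BWord J), BWord.IdxIn P w → BWord.IdxIn Q w
  | BWord.base _, hw => h _ hw
  | BWord.base0, _ => trivial
  | BWord.consJ _ w, hw => ⟨h _ hw.1, BWord.IdxIn.mono h w hw.2⟩
  | BWord.cons0 w, hw => BWord.IdxIn.mono h w hw

variable {X₀ XJ}

/-- **Every iterated bracket is the bracket of a word** in the indices of the embedding. [folklore] -/
theorem IsIteratedLieBracket.exists_word {X : ι → E → E} (emb : ι → Fin J) (hemb : ∀ i, XJ (emb i) = X i)
    {W : E → E} (hW : IsIteratedLieBracket (fun o : Option ι => o.elim X₀ X) W) :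
    ∃ w : BWord J, BWord.IdxIn (· ∈ Set.range emb) w ∧ W = ebr X₀ XJ w := by
  induction hW with
  | of i =>
    cases i with
    | none => exact ⟨BWord.base0, trivial, rfl⟩
    | some i => exact ⟨BWord.base (emb i), ⟨i, rfl⟩, by simp [ebr, hemb]⟩
  | lieBracket i _ ih =>
    obtain ⟨w, hw, rfl⟩ := ih
    cases i with
    | none => exact ⟨BWord.cons0 w, hw, rfl⟩
    | some i => exact ⟨BWord.consJ (emb i) w, ⟨⟨i, rfl⟩, hw⟩, by simp [ebr, hemb]⟩

/-- Smoothness of the word brackets. [folklore] -/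
theorem contDiff_ebr (hX₀ : ContDiff ℝ ∞ X₀) (hXJ : ∀ j, ContDiff ℝ ∞ (XJ j)) : ∀ w, ContDiff ℝ ∞ (ebr X₀ XJ w)
  | BWord.base j => hXJ j
  | BWord.base0 => hX₀
  | BWord.consJ j w => by
    have ih := contDiff_ebr hX₀ hXJ w
    unfold ebr lieBracket
    exact ((ih.fderiv_right (m := ∞) (mod_cast le_top)).clm_apply (hXJ j)).sub
      (((hXJ j).fderiv_right (m := ∞) (mod_cast le_top)).clm_apply ih)
  | BWord.cons0 w => by
    have ih := contDiff_ebr hX₀ hXJ w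
    unfold ebr lieBracket
    exact ((ih.fderiv_right (m := ∞) (mod_cast le_top)).clm_apply hX₀).sub
      ((hX₀.fderiv_right (m := ∞) (mod_cast le_top)).clm_apply ih)

/-- **Pushforward of the word brackets**: `T_* (ebr w) = vbr (T_* XJ) (T_* X₀) w`. [folklore] -/
theorem push_ebr (T : E ≃L[ℝ] V) (hX₀ : ContDiff ℝ ∞ X₀) (hXJ : ∀ j, ContDiff ℝ ∞ (XJ j)) :
    ∀ w, push T (ebr X₀ XJ w) = vbr (fun j => push T (XJ j)) (push T X₀) w
  | BWord.base j => rfl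
  | BWord.base0 => rfl
  | BWord.consJ j w => by
    simp only [ebr, vbr]
    rw [push_lieBracket T ((hXJ j).differentiable (by simp)) ((contDiff_ebr hX₀ hXJ w).differentiable (by simp)),
      push_ebr T hX₀ hXJ w]
  | BWord.cons0 w => by
    simp only [ebr, vbr]
    rw [push_lieBracket T (hX₀.differentiable (by simp)) ((contDiff_ebr hX₀ hXJ w).differentiable (by simp)),
      push_ebr T hX₀ hXJ w]

/-- **Finitely many spanning brackets** from the bracket condition at a point. [folklore] -/
theorem exists_spanning_words [FiniteDimensional ℝ E] {X : ι → E → E} (emb : ι → Fin J)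
    (hemb : ∀ i, XJ (emb i) = X i) {s : Set E} {x₀ : E} (hx₀ : x₀ ∈ s)
    (hgen : IsBracketGenerating (fun o : Option ι => o.elim X₀ X) s) :
    ∃ (m : ℕ) (w : Fin m → BWord J), (∀ i, BWord.IdxIn (· ∈ Set.range emb) (w i)) ∧
      Submodule.span ℝ (Set.range fun i => ebr X₀ XJ (w i) x₀) = ⊤ := by
  set S : Set E := {v : E | ∃ W : E → E, IsIteratedLieBracket (fun o : Option ι => o.elim X₀ X) W ∧ W x₀ = v}
  have hS : Submodule.span ℝ S = ⊤ := hgen x₀ hx₀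
  obtain ⟨b, hbS, hbspan, hbli⟩ := exists_linearIndependent ℝ S
  have hbfin : b.Finite := hbli.setFinite
  obtain ⟨m, f, hf⟩ := hbfin.fin_embedding
  have hfS : ∀ i, f i ∈ S := fun i => hbS (hf ▸ Set.mem_range_self i)
  choose W hW hWx using hfS
  choose w hwidx hw using fun i => IsIteratedLieBracket.exists_word emb hemb (hW i)
  refine ⟨m, w, hwidx, ?_⟩
  have hrange : (Set.range fun i => ebr X₀ XJ (w i) x₀) = b := by
    rw [← hf]
    ext v
    simp only [Set.mem_range]
    constructor
    · rintro ⟨i, rfl⟩; exact ⟨i, by rw [← hWx i, hw i]⟩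
    · rintro ⟨i, rfl⟩; exact ⟨i, by rw [← hw i, hWx i]⟩
  rw [hrange, hbspan, hS]

end WordsE

end Literature.Analysis.Hypoelliptic
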